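import Summits.Ventures.PercRepro.GenQClassElevenSixteen

/-!
# PercRepro — the corank-`11` split, part C: two `16`-traces leave no `15`-trace (night-4, gen 14)

The integer split of the type-`6`, corank-`11` LP on the top trace counts `(h₁₆, h₁₅)` (`n = 18`) is negative on tree
rows exactly on the classes `h₁₆ ∈ {2, 3}`, `h₁₅ ≥ 1` (`−30,377 / −30,860`, kit j269615) and on the `h₁₆ = 1` half of
`(h₁₅ = 5, h₁₄ = 0)` (part B).  This file proves the former EMPTY: **`hypTr_fifteen_eq_zero_of_two_le_sixteen`** — two
distinct `16`-traces `K, K′` meet in a rank-`5` flat `F` with `f ∈ {14, 15}` points of `G`; a `15`-trace `H` shares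
`≥ 15 + f − 18 ≥ 11 > 10` points with `F`, so `F ⊆ H`.  For `f = 15` the trace of `H` is `F ∩ G`, of rank `5` — not
spanning.  For `f = 14` the four points of `G ∖ F` are the two of `K` and the two of `K′` (disjoint: `K ∩ K′ = F`), and
the one point of `H` outside `F` lies in `K` or `K′`; but a point `x ∉ F` common to two hyperplanes through `F` makes
both equal to `cl(F ∪ x)` (`eq_of_mem_of_subset_flatsQ_six`), and `H ≠ K, K′` by the trace sizes.
Imports `GenQClassElevenSixteen` (part A) only.
-/
namespace PercRepro.Night4

open Finset ThmH SixFour GenQ PerFlat Star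

variable {α : Type*} [DecidableEq α] {M : Matroid α} [M.Finite]

/-- Two rank-`6` flats through a rank-`5` flat `F` and a common point `x ∉ F` coincide. -/
theorem eq_of_mem_of_subset_flatsQ_six {F H K : Finset α} (hF : F ∈ flatsQ M 5) (hH : H ∈ flatsQ M 6)
    (hK : K ∈ flatsQ M 6) (hFH : F ⊆ H) (hFK : F ⊆ K) {x : α} (hxE : x ∈ M.E) (hxF : x ∉ F) (hxH : x ∈ H)
    (hxK : x ∈ K) : H = K := by
  have hF' := mem_flatsQ.1 hF
  have hrx : M.eRk ((insert x F : Finset α) : Set α) = ((6 : ℕ) : ℕ∞) := by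
    rw [Finset.coe_insert, Matroid.eRk_insert_eq_add_one, hF'.2.2]
    · norm_num
    · rw [Set.mem_sdiff, hF'.2.1.closure]
      exact ⟨hxE, fun h => hxF (Finset.mem_coe.1 h)⟩
  have hsub : H ⊆ K :=
    subset_of_subset_of_eRk_eq hH (mem_flatsQ.1 hK).2.1 (Finset.insert_subset hxH hFH)
      (Finset.insert_subset hxK hFK) hrx
  exact eq_of_subset_of_mem_flatsQ hH hK hsub

/-- **Two `16`-traces leave no `15`-trace** (`n = 18`, `q = 7`, the core): the classes `h₁₆ ≥ 2`, `h₁₅ ≥ 1` of the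
corank-`11` split are empty. -/
theorem hypTr_fifteen_eq_zero_of_two_le_sixteen (hs : Simple M) (hline : ∀ L ∈ flatsQ M 2, L.card ≤ 3)
    (hplane : ∀ P ∈ flatsQ M 3, P.card ≤ 6) (hsolid : ∀ F ∈ flatsQ M 4, F.card ≤ 10) {G : Finset α}
    (hG : G ⊆ gr M) (hcard : G.card = 18) (h16 : 2 ≤ hypTr M G 6 16) : hypTr M G 6 15 = 0 := by
  have hB := flats_le_four_card_le_ten hs hline hplane hsolid
  unfold hypTr at h16 ⊢
  obtain ⟨K, K', hK, hK', hne⟩ := Finset.one_lt_card_iff.1 (by omega : 1 < (flatsTr M G 6 16).card)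
  have hK1 := mem_flatsTr.1 hK
  have hK1' := mem_flatsTr.1 hK'
  -- `F = K ∩ K′` is a rank-`5` flat with `14` or `15` points of `G`
  have hF : K ∩ K' ∈ flatsQ M 5 :=
    inter_mem_flatsQ_of_large_traces (q := 7) (s := 16) (B := 10) (by norm_num) hB hK hK' hne (by omega)
  have hF' := mem_flatsQ.1 hF
  have hf14 := two_mul_sub_le_card_inter_of_mem_flatsTr hK hK'
  have hfle : ((K ∩ K') ∩ G).card ≤ 15 := by
    by_contra hlt
    rw [not_le] at hlt
    have hsub : (K ∩ K') ∩ G ⊆ K ∩ G := by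
      intro x hx
      rw [Finset.mem_inter] at hx ⊢
      exact ⟨(Finset.mem_inter.1 hx.1).1, hx.2⟩
    have hsub' : (K ∩ K') ∩ G ⊆ K' ∩ G := by
      intro x hx
      rw [Finset.mem_inter] at hx ⊢
      exact ⟨(Finset.mem_inter.1 hx.1).2, hx.2⟩
    have heq : (K ∩ K') ∩ G = K ∩ G := Finset.eq_of_subset_of_card_le hsub (by omega)
    have heq' : (K ∩ K') ∩ G = K' ∩ G := Finset.eq_of_subset_of_card_le hsub' (by omega)
    exact hne (eq_of_inter_eq_of_mem_flatsTr hK hK' (heq.symm.trans heq'))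
  rw [Finset.card_eq_zero, Finset.eq_empty_iff_forall_notMem]
  intro H hH
  have hH1 := mem_flatsTr.1 hH
  -- `F ⊆ H`
  have hFH : K ∩ K' ⊆ H := by
    refine subset_of_eleven_le_card_inter hB hF (mem_flatsQ.1 hH1.1).2.1 ?_
    have hsub : ((K ∩ K') ∩ G) ∩ (H ∩ G) ⊆ (K ∩ K') ∩ H := by
      intro x hx
      rw [Finset.mem_inter] at hx ⊢
      exact ⟨(Finset.mem_inter.1 hx.1).1, (Finset.mem_inter.1 hx.2).1⟩
    have hU : ((K ∩ K') ∩ G) ∪ (H ∩ G) ⊆ G := by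
      intro x hx
      simp only [Finset.mem_union, Finset.mem_inter] at hx
      rcases hx with hx | hx
      · exact hx.2
      · exact hx.2
    have h1 := Finset.card_union_add_card_inter ((K ∩ K') ∩ G) (H ∩ G)
    have h2 := Finset.card_le_card hU
    have h3 := Finset.card_le_card hsub
    rw [hH1.2.1] at h1
    omega
  have hFGH : (K ∩ K') ∩ G ⊆ H ∩ G := by
    intro x hx
    rw [Finset.mem_inter] at hx ⊢
    exact ⟨hFH hx.1, hx.2⟩
  -- the point of `H ∩ G` outside `F` (there is one: the trace of `H` spans rank `6`, `F` has rank `5`)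
  have hHnot : ¬ H ∩ G ⊆ K ∩ K' := by
    intro hsub
    have hle : M.eRk ((H ∩ G : Finset α) : Set α) ≤ M.eRk ((K ∩ K' : Finset α) : Set α) :=
      M.eRk_mono (Finset.coe_subset.2 hsub)
    rw [hH1.2.2, hF'.2.2] at hle
    have : (6 : ℕ) ≤ 5 := by exact_mod_cast hle
    omega
  obtain ⟨x, hxH, hxF⟩ := Finset.not_subset.1 hHnot
  rw [Finset.mem_inter] at hxH
  have hxE : x ∈ M.E := by
    rw [← coe_gr M]
    exact Finset.mem_coe.2 (hG hxH.2)
  -- `x ∈ K` or `x ∈ K′`: the four points of `G ∖ F` are those of `K` and `K′` (two each, disjoint)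
  have hxKK : x ∈ K ∨ x ∈ K' := by
    by_contra hnot
    rw [not_or] at hnot
    -- `(H ∩ G) ∖ F`, `(K ∩ G) ∖ F`, `(K′ ∩ G) ∖ F` are pairwise disjoint subsets of `G ∖ F`
    have hdisj : Disjoint ((K ∩ G) \ (K ∩ K')) ((K' ∩ G) \ (K ∩ K')) := by
      rw [Finset.disjoint_left]
      intro z hz hz'
      rw [Finset.mem_sdiff, Finset.mem_inter] at hz hz'
      exact hz.2 (Finset.mem_inter.2 ⟨hz.1.1, hz'.1.1⟩)
    have hcK : ((K ∩ G) \ (K ∩ K')).card = 16 - ((K ∩ K') ∩ G).card := by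
      have hEq : (K ∩ K') ∩ (K ∩ G) = (K ∩ K') ∩ G := by
        ext z
        simp only [Finset.mem_inter]
        tauto
      rw [Finset.card_sdiff, hK1.2.1, hEq]
    have hcK' : ((K' ∩ G) \ (K ∩ K')).card = 16 - ((K ∩ K') ∩ G).card := by
      have hEq : (K ∩ K') ∩ (K' ∩ G) = (K ∩ K') ∩ G := by
        ext z
        simp only [Finset.mem_inter]
        tauto
      rw [Finset.card_sdiff, hK1'.2.1, hEq]
    have hsub : insert x (((K ∩ G) \ (K ∩ K')) ∪ ((K' ∩ G) \ (K ∩ K'))) ⊆ G \ (K ∩ K') := by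
      intro z hz
      simp only [Finset.mem_insert, Finset.mem_union, Finset.mem_sdiff, Finset.mem_inter] at hz
      rw [Finset.mem_sdiff]
      rcases hz with hz | hz | hz
      · rw [hz]; exact ⟨hxH.2, hxF⟩
      · exact ⟨hz.1.2, fun h => hz.2 (Finset.mem_inter.1 h)⟩
      · exact ⟨hz.1.2, fun h => hz.2 (Finset.mem_inter.1 h)⟩
    have hxnot : x ∉ ((K ∩ G) \ (K ∩ K')) ∪ ((K' ∩ G) \ (K ∩ K')) := by
      simp only [Finset.mem_union, Finset.mem_sdiff, Finset.mem_inter]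
      rintro (h | h)
      · exact hnot.1 h.1.1
      · exact hnot.2 h.1.1
    have hcard' := Finset.card_le_card hsub
    rw [Finset.card_insert_of_notMem hxnot, Finset.card_union_of_disjoint hdisj, hcK, hcK', Finset.card_sdiff,
      hcard] at hcard'
    -- `f = 15` is excluded by `x`: the trace of `H` would be `F ∩ G`
    have hf15 : ((K ∩ K') ∩ G).card ≠ 15 := by
      intro h15
      have heq : (K ∩ K') ∩ G = H ∩ G := Finset.eq_of_subset_of_card_le hFGH (by omega)
      have : x ∈ (K ∩ K') ∩ G := by rw [heq]; exact Finset.mem_inter.2 hxH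
      exact hxF (Finset.mem_inter.1 this).1
    omega
  -- a common point outside `F` of two hyperplanes through `F` identifies them — but `H` has a `15`-trace, `K` a `16`-trace
  rcases hxKK with hxK | hxK'
  · exact ne_of_mem_flatsTr_of_card_ne hH hK (by norm_num)
      (eq_of_mem_of_subset_flatsQ_six hF hH1.1 hK1.1 hFH Finset.inter_subset_left hxE hxF hxH.1 hxK)
  · exact ne_of_mem_flatsTr_of_card_ne hH hK' (by norm_num)
      (eq_of_mem_of_subset_flatsQ_six hF hH1.1 hK1'.1 hFH Finset.inter_subset_right hxE hxF hxH.1 hxK')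

end PercRepro.Night4
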